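/-
Copyright (c) 2026 the pub-hodgecm-mathlib formalisation cell (harness21).  Prover seat hodgecm-mathlib-LH4-p10 (g9), Track B ∕ R90-TF, h413 = `stmt-HodgeConjecture-24833`,
R90-TF section S8 «ContSpec-n½» (S8 dealer R90-CS-plan (g3) S8-R239 (1) «= (iii)», ruling J-S8-FN): the ONE-PLACE FACTORISATION of the residue operator `M₋₁` through a local factor
`N_v(3∕2)` — kernel, image, non-degeneracy and `G_v`-equivariance of `Θ_{φ^v} : φ_v ↦ M₋₁(φ_v ⊗ φ^v)` — as PURE LINEAR ALGEBRA over displayed letters (the section dictionary, the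
tensor clause of FACT-N, the local factor).  The slot where the orientation corollary «`ker N_v = π²(ξ_v)`, `I_v ∕ ker N_v ≅ πⁿ(ξ_v)`» (K2Liu-p10 (g7)) meets RES-INT line 7 (K2E1-p10 (g6)).
-/
import Mathlib.LinearAlgebra.Isomorphisms
import Mathlib.LinearAlgebra.Pi
import Mathlib.RepresentationTheory.Basic
import HarnessLib

/-!
# S8 J-S8-FN (iii) — `R90S8IntertwiningResidueKernelOfFactorisationU3`: KERNEL AND IMAGE OF THE RESIDUE OPERATOR THROUGH A ONE-PLACE FACTORISATION

Track B ∕ R90-TF, crux h413 = `stmt-HodgeConjecture-24833`, route of record `HCCMUnconditional`; cell `hodgecm-mathlib`, R90-TF section S8 «ContSpec-n½ ∕ ResidualSpectrum», RES-INT road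
(M-a) line 7 input (consumer K2E1-p10 (g6), steps (7a)–(7b)); FACT-N (J-S8-FN): (a) algebraic = orientation corollary (K2Liu-p10 (g7)), (b) good places ★, (c) `v ∣ 𝔫` letter-only.
THEOREMS ONLY (no `def`, no `instance`, no `notation`, no named-fact hypothesis, no `sorry`; default heartbeats); lane `--supports stmt-HodgeConjecture-24833 --as helper` (count-neutral).
CLOSES NO SOCKET.  Pure linear algebra (Mathlib `LinearMap.ker ∕ range`, `Submodule.map ∕ pi`, `LinearMap.quotKerEquivRange`, `Representation`); no measure, no Eisenstein series.

THE MATHEMATICS ([MoeglinWaldspurger1995] II.1.6–II.1.7, IV.1.9–IV.1.11; [Langlands1976] §6–§7).  The global intertwining operator factorises as `M(z) = m(z)·⊗_v N_v(z)` with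
normalised local factors; at the simple pole `z₀ = 3∕2` its residue is `M₋₁ = (Res m)·⊗_v N_v(3∕2)`.  Fix a place `v` and read sections of the global block `V` through a SECTION DICTIONARY
`T : φ_v ⊗ φ^v ↦ φ` (bilinear in the local vector `φ_v ∈ I_v` and the tail `φ^v`), and the values through a target dictionary `Tʷ`.  The TENSOR CLAUSE of FACT-N is the letter
`hfac : M₋₁(T(φ_v, φ^v)) = Tʷ(N_v φ_v, R^v φ^v)` with `N_v = N_v(3∕2)` the local factor and `R^v = (Res m)·⊗_{w ≠ v} N_w(3∕2)` the tail residue; pure tensors vanish only trivially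
(`hTw : Tʷ(w, y) = 0 → w = 0 ∨ y = 0`).  Then for every tail with `R^v φ^v ≠ 0` the map `Θ_{φ^v} := M₋₁ ∘ T(·, φ^v) : I_v → X` has **`ker Θ_{φ^v} = ker N_v`**, image `Tʷ(range N_v, R^v φ^v)
≅ range N_v ≅ I_v ∕ ker N_v`, is zero iff `N_v = 0`, has `⊥ ≠ ker ≠ ⊤` iff `N_v` does; on `k` tails at once `Θ` kills `(ker N_v)^{⊕k}`; and when the dictionary is `G_v`-equivariant in the
local slot and `M₋₁` is `G_v`-equivariant (RES-INT line 6, ★ `ctResidue_translate_eq_sum_of_letters` at `g = ι_v(g_v)`), `Θ_{φ^v}` is a `G_v`-map and its kernel and image are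
`G_v`-stable — so the orientation corollary (`ker N_v = π²(ξ_v)` the unique proper non-zero stable subspace, quotient `≅ πⁿ(ξ_v)`) identifies the local constituent that `M₋₁` produces.
* §1 one tail: `residue_dict_apply`, `residue_dict_eq_targetDict_comp_local`, `residue_dict_eq_zero_of_local_eq_zero`, `ker_local_le_ker_residue_dict`, **`ker_residue_dict_eq`**,
  `range_residue_dict_eq`, `injective_targetDict_flip`, **`nonempty_range_local_equiv_range_residue_dict`**, **`nonempty_quotient_ker_local_equiv_range_residue_dict`**,
  `residue_dict_eq_zero_iff`, `ker_residue_dict_eq_bot_iff`, `ker_residue_dict_eq_top_iff` (+ `ne` forms).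
* §2 `k` tails: `residue_dictSum_eq_zero_of_forall_local_eq_zero`, **`pi_ker_local_le_ker_residue_dictSum`** (`Θ` kills `(ker N_v)^{⊕k}` — (7a)'s input shape).
* §3 equivariance: **`residue_dict_equivariant`**, `ker_residue_dict_map_mem`, `range_residue_dict_map_mem`.
HONEST LABEL: HC_CM is proved only modulo the 7 printed citations (2 remaining named inputs: hLiu418 = `stmt-HodgeConjecture-24832`, h413 = `stmt-HodgeConjecture-24833`) until
rung 0 closes; REL ≠ ★ ≠ BUILT; every analytic ∕ local input is a displayed letter (`hfac` = FACT-N's tensor clause, `Nv` letter-only at `v ∣ 𝔫`, the dictionary `T` unowned — K2E1-p10's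
(5)(a)); pays no socket; count-neutral.

## References
* [MoeglinWaldspurger1995] C. Mœglin, J.-L. Waldspurger, *Spectral Decomposition and Eisenstein Series* (1995), II.1.6–II.1.7, IV.1.9–IV.1.11.
* [Langlands1976] R. P. Langlands, *On the Functional Equations Satisfied by Eisenstein Series*, LNM 544 (1976), §6–§7.
-/

set_option autoImplicit false
set_option linter.dupNamespace false  -- the mandated namespace `…HodgeConjecture.HodgeConjecture.R90.S8` (LEAD #1 L1) repeats the summit's segment

namespace Summit.HodgeConjecture.HodgeConjecture.R90.S8

variable {𝕜 : Type*} [CommRing 𝕜]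
variable {Vv Wv Vt Xt V X : Type*} [AddCommGroup Vv] [Module 𝕜 Vv] [AddCommGroup Wv] [Module 𝕜 Wv] [AddCommGroup Vt] [Module 𝕜 Vt]
  [AddCommGroup Xt] [Module 𝕜 Xt] [AddCommGroup V] [Module 𝕜 V] [AddCommGroup X] [Module 𝕜 X]

/-! ## §1 One tail: kernel, image and non-degeneracy of `Θ_{φ^v} = M₋₁ ∘ T(·, φ^v)` -/

section OneTail

variable (T : Vv →ₗ[𝕜] Vt →ₗ[𝕜] V) (Tw : Wv →ₗ[𝕜] Xt →ₗ[𝕜] X) (R : V →ₗ[𝕜] X) (Nv : Vv →ₗ[𝕜] Wv) (Rt : Vt →ₗ[𝕜] Xt)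

/-- Unfolding `Θ_{φ^v} = M₋₁ ∘ T(·, φ^v)`: `(R ∘ₗ T.flip φt) xv = R (T xv φt)`. [cite: MoeglinWaldspurger1995, II.1.6] -/
theorem residue_dict_apply (φt : Vt) (xv : Vv) : (R ∘ₗ T.flip φt) xv = R (T xv φt) := rfl

/-- **The factorisation as an identity of linear maps**: under the tensor clause `hfac`, `Θ_{φ^v} = Tʷ(·, R^v φ^v) ∘ N_v`. [cite: MoeglinWaldspurger1995, II.1.6, IV.1.9] [cite: Langlands1976, §6] -/
theorem residue_dict_eq_targetDict_comp_local (hfac : ∀ (xv : Vv) (φt : Vt), R (T xv φt) = Tw (Nv xv) (Rt φt)) (φt : Vt) :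
    R ∘ₗ T.flip φt = Tw.flip (Rt φt) ∘ₗ Nv := by
  ext xv
  simp only [LinearMap.comp_apply, LinearMap.flip_apply, hfac]

/-- **`N_v φ_v = 0 ⇒ M₋₁(φ_v ⊗ φ^v) = 0` for every tail.** [cite: MoeglinWaldspurger1995, IV.1.9–IV.1.11] -/
theorem residue_dict_eq_zero_of_local_eq_zero (hfac : ∀ (xv : Vv) (φt : Vt), R (T xv φt) = Tw (Nv xv) (Rt φt)) {xv : Vv} (hx : Nv xv = 0) (φt : Vt) :
    R (T xv φt) = 0 := by
  rw [hfac, hx, map_zero, LinearMap.zero_apply]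

/-- **`ker N_v ≤ ker Θ_{φ^v}`** (no hypothesis on the tail). [cite: MoeglinWaldspurger1995, IV.1.9–IV.1.11] -/
theorem ker_local_le_ker_residue_dict (hfac : ∀ (xv : Vv) (φt : Vt), R (T xv φt) = Tw (Nv xv) (Rt φt)) (φt : Vt) :
    LinearMap.ker Nv ≤ LinearMap.ker (R ∘ₗ T.flip φt) := fun _ hx =>
  LinearMap.mem_ker.2 (residue_dict_eq_zero_of_local_eq_zero T Tw R Nv Rt hfac (LinearMap.mem_ker.1 hx) φt)

/-- **`ker Θ_{φ^v} = ker N_v` FOR A LIVE TAIL (`R^v φ^v ≠ 0`)**: the kernel of the residue operator on pure tensors with a fixed live tail is exactly the kernel of the local factor — the slot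
of the orientation corollary `ker N_v = π²(ξ_v)`. [cite: MoeglinWaldspurger1995, IV.1.9–IV.1.11] [cite: Langlands1976, §7] -/
theorem ker_residue_dict_eq (hfac : ∀ (xv : Vv) (φt : Vt), R (T xv φt) = Tw (Nv xv) (Rt φt)) (hTw : ∀ (w : Wv) (y : Xt), Tw w y = 0 → w = 0 ∨ y = 0)
    {φt : Vt} (hφt : Rt φt ≠ 0) :
    LinearMap.ker (R ∘ₗ T.flip φt) = LinearMap.ker Nv := by
  refine le_antisymm (fun xv hx => ?_) (ker_local_le_ker_residue_dict T Tw R Nv Rt hfac φt)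
  rw [LinearMap.mem_ker, residue_dict_apply, hfac] at hx
  exact LinearMap.mem_ker.2 ((hTw _ _ hx).resolve_right hφt)

/-- **The image of `Θ_{φ^v}` is `Tʷ(range N_v, R^v φ^v)`.** [cite: MoeglinWaldspurger1995, IV.1.9–IV.1.11] -/
theorem range_residue_dict_eq (hfac : ∀ (xv : Vv) (φt : Vt), R (T xv φt) = Tw (Nv xv) (Rt φt)) (φt : Vt) :
    LinearMap.range (R ∘ₗ T.flip φt) = (LinearMap.range Nv).map (Tw.flip (Rt φt)) := by
  rw [residue_dict_eq_targetDict_comp_local T Tw R Nv Rt hfac φt, LinearMap.range_comp]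

omit [AddCommGroup Vv] [Module 𝕜 Vv] [AddCommGroup Vt] [Module 𝕜 Vt] [AddCommGroup V] [Module 𝕜 V] in
/-- **A live value `y ≠ 0` gives an injective slice `Tʷ(·, y)`** when pure tensors vanish only trivially. [folklore] -/
theorem injective_targetDict_flip (hTw : ∀ (w : Wv) (y : Xt), Tw w y = 0 → w = 0 ∨ y = 0) {y : Xt} (hy : y ≠ 0) :
    Function.Injective (Tw.flip y) :=
  (injective_iff_map_eq_zero (Tw.flip y)).2 fun w hw => (hTw w y (by rwa [LinearMap.flip_apply] at hw)).resolve_right hy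

/-- **`range Θ_{φ^v} ≃ range N_v`** for a live tail (the injective slice `Tʷ(·, R^v φ^v)` transports the image of the local factor). [cite: MoeglinWaldspurger1995, IV.1.9–IV.1.11] -/
theorem nonempty_range_local_equiv_range_residue_dict (hfac : ∀ (xv : Vv) (φt : Vt), R (T xv φt) = Tw (Nv xv) (Rt φt))
    (hTw : ∀ (w : Wv) (y : Xt), Tw w y = 0 → w = 0 ∨ y = 0) {φt : Vt} (hφt : Rt φt ≠ 0) :
    Nonempty (↥(LinearMap.range Nv) ≃ₗ[𝕜] ↥(LinearMap.range (R ∘ₗ T.flip φt))) :=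
  ⟨(Submodule.equivMapOfInjective (Tw.flip (Rt φt)) (injective_targetDict_flip Tw hTw hφt) (LinearMap.range Nv)).trans
    (LinearEquiv.ofEq _ _ (range_residue_dict_eq T Tw R Nv Rt hfac φt).symm)⟩

/-- **FIRST ISOMORPHISM: `I_v ∕ ker N_v ≃ range Θ_{φ^v}`** for a live tail — the slot where the orientation corollary `I_v ∕ ker N_v ≅ πⁿ(ξ_v)` identifies the local constituent produced
by the residue operator. [cite: MoeglinWaldspurger1995, IV.1.9–IV.1.11] [cite: Langlands1976, §7] -/
theorem nonempty_quotient_ker_local_equiv_range_residue_dict (hfac : ∀ (xv : Vv) (φt : Vt), R (T xv φt) = Tw (Nv xv) (Rt φt))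
    (hTw : ∀ (w : Wv) (y : Xt), Tw w y = 0 → w = 0 ∨ y = 0) {φt : Vt} (hφt : Rt φt ≠ 0) :
    Nonempty ((Vv ⧸ LinearMap.ker Nv) ≃ₗ[𝕜] ↥(LinearMap.range (R ∘ₗ T.flip φt))) :=
  ⟨(Submodule.quotEquivOfEq _ _ (ker_residue_dict_eq T Tw R Nv Rt hfac hTw hφt).symm).trans (LinearMap.quotKerEquivRange (R ∘ₗ T.flip φt))⟩

/-- **`Θ_{φ^v} = 0 ↔ N_v = 0`** for a live tail. [cite: MoeglinWaldspurger1995, IV.1.9–IV.1.11] -/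
theorem residue_dict_eq_zero_iff (hfac : ∀ (xv : Vv) (φt : Vt), R (T xv φt) = Tw (Nv xv) (Rt φt)) (hTw : ∀ (w : Wv) (y : Xt), Tw w y = 0 → w = 0 ∨ y = 0)
    {φt : Vt} (hφt : Rt φt ≠ 0) :
    R ∘ₗ T.flip φt = 0 ↔ Nv = 0 := by
  rw [← LinearMap.ker_eq_top, ← LinearMap.ker_eq_top, ker_residue_dict_eq T Tw R Nv Rt hfac hTw hφt]

/-- **`Θ_{φ^v} ≠ 0 ↔ N_v ≠ 0`** for a live tail (the letter «`N_v(3∕2) ≠ 0`» transfers both ways). [cite: MoeglinWaldspurger1995, IV.1.9–IV.1.11] -/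
theorem residue_dict_ne_zero_iff (hfac : ∀ (xv : Vv) (φt : Vt), R (T xv φt) = Tw (Nv xv) (Rt φt)) (hTw : ∀ (w : Wv) (y : Xt), Tw w y = 0 → w = 0 ∨ y = 0)
    {φt : Vt} (hφt : Rt φt ≠ 0) :
    R ∘ₗ T.flip φt ≠ 0 ↔ Nv ≠ 0 :=
  not_congr (residue_dict_eq_zero_iff T Tw R Nv Rt hfac hTw hφt)

/-- **`ker Θ_{φ^v} = ⊥ ↔ ker N_v = ⊥`** for a live tail. [cite: MoeglinWaldspurger1995, IV.1.9–IV.1.11] -/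
theorem ker_residue_dict_eq_bot_iff (hfac : ∀ (xv : Vv) (φt : Vt), R (T xv φt) = Tw (Nv xv) (Rt φt)) (hTw : ∀ (w : Wv) (y : Xt), Tw w y = 0 → w = 0 ∨ y = 0)
    {φt : Vt} (hφt : Rt φt ≠ 0) :
    LinearMap.ker (R ∘ₗ T.flip φt) = ⊥ ↔ LinearMap.ker Nv = ⊥ := by
  rw [ker_residue_dict_eq T Tw R Nv Rt hfac hTw hφt]

/-- **`ker Θ_{φ^v} ≠ ⊥ ↔ ker N_v ≠ ⊥`** for a live tail (the letter «`⊥ ≠ ker`» transfers). [cite: MoeglinWaldspurger1995, IV.1.9–IV.1.11] -/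
theorem ker_residue_dict_ne_bot_iff (hfac : ∀ (xv : Vv) (φt : Vt), R (T xv φt) = Tw (Nv xv) (Rt φt)) (hTw : ∀ (w : Wv) (y : Xt), Tw w y = 0 → w = 0 ∨ y = 0)
    {φt : Vt} (hφt : Rt φt ≠ 0) :
    LinearMap.ker (R ∘ₗ T.flip φt) ≠ ⊥ ↔ LinearMap.ker Nv ≠ ⊥ :=
  not_congr (ker_residue_dict_eq_bot_iff T Tw R Nv Rt hfac hTw hφt)

/-- **`ker Θ_{φ^v} = ⊤ ↔ ker N_v = ⊤`** for a live tail. [cite: MoeglinWaldspurger1995, IV.1.9–IV.1.11] -/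
theorem ker_residue_dict_eq_top_iff (hfac : ∀ (xv : Vv) (φt : Vt), R (T xv φt) = Tw (Nv xv) (Rt φt)) (hTw : ∀ (w : Wv) (y : Xt), Tw w y = 0 → w = 0 ∨ y = 0)
    {φt : Vt} (hφt : Rt φt ≠ 0) :
    LinearMap.ker (R ∘ₗ T.flip φt) = ⊤ ↔ LinearMap.ker Nv = ⊤ := by
  rw [ker_residue_dict_eq T Tw R Nv Rt hfac hTw hφt]

/-- **`ker Θ_{φ^v} ≠ ⊤ ↔ ker N_v ≠ ⊤`** for a live tail (the letter «`ker ≠ ⊤`» transfers). [cite: MoeglinWaldspurger1995, IV.1.9–IV.1.11] -/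
theorem ker_residue_dict_ne_top_iff (hfac : ∀ (xv : Vv) (φt : Vt), R (T xv φt) = Tw (Nv xv) (Rt φt)) (hTw : ∀ (w : Wv) (y : Xt), Tw w y = 0 → w = 0 ∨ y = 0)
    {φt : Vt} (hφt : Rt φt ≠ 0) :
    LinearMap.ker (R ∘ₗ T.flip φt) ≠ ⊤ ↔ LinearMap.ker Nv ≠ ⊤ :=
  not_congr (ker_residue_dict_eq_top_iff T Tw R Nv Rt hfac hTw hφt)

end OneTail

/-! ## §2 Finitely many tails at once: `Θ` kills `(ker N_v)^{⊕k}` -/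

section ManyTails

variable (T : Vv →ₗ[𝕜] Vt →ₗ[𝕜] V) (Tw : Wv →ₗ[𝕜] Xt →ₗ[𝕜] X) (R : V →ₗ[𝕜] X) (Nv : Vv →ₗ[𝕜] Wv) (Rt : Vt →ₗ[𝕜] Xt)

/-- **`M₋₁(Σᵢ φ_{v,i} ⊗ φ^v_i) = 0` when every `φ_{v,i} ∈ ker N_v`.** [cite: MoeglinWaldspurger1995, IV.1.9–IV.1.11] -/
theorem residue_dictSum_eq_zero_of_forall_local_eq_zero (hfac : ∀ (xv : Vv) (φt : Vt), R (T xv φt) = Tw (Nv xv) (Rt φt))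
    {ι : Type*} (s : Finset ι) (φt : ι → Vt) {xv : ι → Vv} (hx : ∀ i ∈ s, Nv (xv i) = 0) :
    R (∑ i ∈ s, T (xv i) (φt i)) = 0 := by
  rw [map_sum]
  exact Finset.sum_eq_zero fun i hi => residue_dict_eq_zero_of_local_eq_zero T Tw R Nv Rt hfac (hx i hi) (φt i)

/-- **`(ker N_v)^{⊕ι} ≤ ker (M₋₁ ∘ Σᵢ T(·ᵢ, φ^v_i))`**: on the direct sum `ι → I_v` read through finitely many tails, the residue operator kills `(ker N_v)^{⊕ι}` — the input shape of the
(7a) step «a `G_v`-map out of `S̃ ≤ I_v^{⊕k}` killing `S̃ ∩ K_v^{⊕k}`». [cite: MoeglinWaldspurger1995, IV.1.9–IV.1.11] -/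
theorem pi_ker_local_le_ker_residue_dictSum (hfac : ∀ (xv : Vv) (φt : Vt), R (T xv φt) = Tw (Nv xv) (Rt φt))
    {ι : Type*} [Fintype ι] (φt : ι → Vt) :
    Submodule.pi Set.univ (fun _ : ι => LinearMap.ker Nv) ≤ LinearMap.ker (R ∘ₗ ∑ i, T.flip (φt i) ∘ₗ LinearMap.proj i) := fun xv hx => by
  rw [LinearMap.mem_ker, LinearMap.comp_apply, LinearMap.sum_apply]
  simp only [LinearMap.comp_apply, LinearMap.proj_apply, LinearMap.flip_apply]
  exact residue_dictSum_eq_zero_of_forall_local_eq_zero T Tw R Nv Rt hfac Finset.univ φt fun i _ =>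
    LinearMap.mem_ker.1 ((Submodule.mem_pi.1 hx) i (Set.mem_univ i))

/-- **The `⊕ι`-map applied**: `(R ∘ₗ Σᵢ T(·, φ^v_i) ∘ projᵢ) xv = R (Σᵢ T (xv i) (φ^v_i))`. [cite: MoeglinWaldspurger1995, II.1.6] -/
theorem residue_dictSum_apply {ι : Type*} [Fintype ι] (φt : ι → Vt) (xv : ι → Vv) :
    (R ∘ₗ ∑ i, T.flip (φt i) ∘ₗ LinearMap.proj i) xv = R (∑ i, T (xv i) (φt i)) := by
  rw [LinearMap.comp_apply, LinearMap.sum_apply]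
  simp only [LinearMap.comp_apply, LinearMap.proj_apply, LinearMap.flip_apply]

end ManyTails

/-! ## §3 `G_v`-equivariance of `Θ_{φ^v}`; its kernel and image are `G_v`-stable -/

section Equivariance

variable {Gv : Type*} [Monoid Gv]
variable (T : Vv →ₗ[𝕜] Vt →ₗ[𝕜] V) (R : V →ₗ[𝕜] X) (ρV : Representation 𝕜 Gv Vv) (ρ : Representation 𝕜 Gv V) (σ : Representation 𝕜 Gv X)

/-- **`Θ_{φ^v}` IS A `G_v`-MAP** when the dictionary is `G_v`-equivariant in the local slot (tail fixed) and the residue operator is `G_v`-equivariant (RES-INT line 6 at `g = ι_v(g_v)`):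
`Θ(g·φ_v) = g·Θ(φ_v)`. [cite: MoeglinWaldspurger1995, II.1.6, IV.1.9–IV.1.11] -/
theorem residue_dict_equivariant (hT : ∀ (g : Gv) (xv : Vv) (φt : Vt), T (ρV g xv) φt = ρ g (T xv φt)) (hR : ∀ (g : Gv) (v : V), R (ρ g v) = σ g (R v))
    (φt : Vt) (g : Gv) (xv : Vv) :
    (R ∘ₗ T.flip φt) (ρV g xv) = σ g ((R ∘ₗ T.flip φt) xv) := by
  simp only [LinearMap.comp_apply, LinearMap.flip_apply, hT, hR]

/-- **`ker Θ_{φ^v}` is `G_v`-stable** (so, with `ker_residue_dict_eq`, `ker N_v` is a `G_v`-stable subspace of `I_v` — a `Subrepresentation` for the (7a) step). [cite: MoeglinWaldspurger1995, IV.1.9–IV.1.11] -/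
theorem ker_residue_dict_map_mem (hT : ∀ (g : Gv) (xv : Vv) (φt : Vt), T (ρV g xv) φt = ρ g (T xv φt)) (hR : ∀ (g : Gv) (v : V), R (ρ g v) = σ g (R v))
    (φt : Vt) {xv : Vv} (hx : xv ∈ LinearMap.ker (R ∘ₗ T.flip φt)) (g : Gv) :
    ρV g xv ∈ LinearMap.ker (R ∘ₗ T.flip φt) := by
  rw [LinearMap.mem_ker] at hx ⊢
  rw [residue_dict_equivariant T R ρV ρ σ hT hR φt g xv, hx, map_zero]

/-- **`range Θ_{φ^v}` is `G_v`-stable** (a `G_v`-stable subspace of the values — the local constituent produced by the residue operator). [cite: MoeglinWaldspurger1995, IV.1.9–IV.1.11] -/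
theorem range_residue_dict_map_mem (hT : ∀ (g : Gv) (xv : Vv) (φt : Vt), T (ρV g xv) φt = ρ g (T xv φt)) (hR : ∀ (g : Gv) (v : V), R (ρ g v) = σ g (R v))
    (φt : Vt) {x : X} (hx : x ∈ LinearMap.range (R ∘ₗ T.flip φt)) (g : Gv) :
    σ g x ∈ LinearMap.range (R ∘ₗ T.flip φt) := by
  obtain ⟨xv, rfl⟩ := LinearMap.mem_range.1 hx
  exact LinearMap.mem_range.2 ⟨ρV g xv, residue_dict_equivariant T R ρV ρ σ hT hR φt g xv⟩

end Equivariance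

end Summit.HodgeConjecture.HodgeConjecture.R90.S8
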